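/-
Origin: expansion seat `planner-pub-hodgecm-pv13-0`, handover 2026-08-18T03:44:03Z (`HOME/pub-hodgecm-pv13/lean/Pv13/EulerProductSmoke.lean`, md5 4f7428d9, 139 lines);
landed by the gen-5 packager in gate run 19 as `HodgeCM/PerL34/EulerProductSmoke.lean` (import ^import Pv13\.CharsAssembly\b→import HodgeCM.PerL34.CharsAssembly ×1).
-/
/-
Origin: pub-hodgecm-pv13 (DAG-NODE PROVER #13), nodes N31h / N31 — NON-VACUITY WITNESS (L5-style smoke model).
Proposed place: `HodgeCM/PerL34/EulerProductSmoke.lean` (or under `HodgeCM/Model/`), after `CharsAssembly`;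
on landing rewrite `import Pv13.CharsAssembly` to the landed module name.  Nothing cited, nothing asserted.
-/
import Summits.HodgeConjecture.HodgeCM.PerL34.CharsAssembly

set_option autoImplicit false

/-!
# Non-vacuity of the N31h / N31 hypothesis packages

`LocalFactorDatum` (N31h) has twelve `Prop`/data constraints and `SideOutputs` (N31) adds the Def 3.2 bridge; the
theorems `analyticHalf`, `allowed_of_localFactorData`, `SideOutputs.allowed_all`, `N31_of_cluster` would be
worthless if those constraints were jointly unsatisfiable.  This file builds an honest instance with NO free
parameters: places `V = ℕ`, exceptional set `S = {0}` with `I₀ = 1`, every other place "split" with `q_v = v + 2`,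
`χ'_v(ϖ_v) = ν_v(ϖ_v) = 1`, so `I_v = Σ_{n∈ℤ} q_v^{-3|n|/2} = (1 − q_v^{-3})/(1 − q_v^{-3/2})²` (the closed form is the
package's `Perl34.C4.eulerFactor`), `vol = 1`, theta vector `1 ∈ ℂ = L²` of the prior programme's one-point smoke
core `Perl34.SmokeS4.core/torus` (Prior/Perl34.lean §SmokeS4, `allowed ≡ True`), and the Siegel–Weil constant
`c := (∏' v, I_v)⁻¹`, which makes the Rallis identity `re⟪1,1⟫ = c · 1 · ∏' I_v` hold on the nose.  Consequently
`AnalyticHalf`, `SideOutputs`, `CharsDischarge` and "every character is allowed" are all INHABITED / derivable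
in a concrete model — the N31 packages are not vacuous.  (The model says nothing about PerL's actual objects.)
-/

noncomputable section

namespace HodgeCM
namespace PerL34
namespace EulerProduct
namespace Smoke

open HodgeCM.Prior.Perl34File

/-- toy residue-field sizes `q_v = v + 2 ≥ 2` -/
def q (v : ℕ) : ℕ := v + 2

/-- (Ported verbatim from the HodgeCMPerL package; no docstring in the source.) -/
theorem two_le_q (v : ℕ) : 2 ≤ q v := by unfold q; omega

/-- toy local factors: `I₀ = 1`; for `v ≥ 1` the split unramified Euler value with `a_v = 1` -/
def I (v : ℕ) : ℝ := if v = 0 then 1 else Perl34.C4.eulerFactor (tOf (q v)) 1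

/-- (Ported verbatim from the HodgeCMPerL package; no docstring in the source.) -/
theorem I_of_ne_zero {v : ℕ} (hv : v ≠ 0) : I v = Perl34.C4.eulerFactor (tOf (q v)) 1 := by
  simp [I, hv]

/-- (Ported verbatim from the HodgeCMPerL package; no docstring in the source.) -/
theorem not_mem_iff (v : ℕ) : v ∉ ({0} : Finset ℕ) ↔ v ≠ 0 := by simp

/-- The tail hypotheses of N31g's outputs hold in the toy model (every place outside `S` split, `a_v = 1`). -/
theorem tail : TailHyps ({0} : Finset ℕ) I q (fun _ => 1) (fun _ => True) where
  two_le_q := fun v _ => two_le_q v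
  a_norm := fun v _ => by simp
  split_val := fun v hv _ => by
    have hv0 : v ≠ 0 := (not_mem_iff v).1 hv
    rw [I_of_ne_zero hv0]
    have h := (Perl34.C4.hasSum_eulerFactor (tOf_nonneg (q v)) (tOf_lt_one (two_le_q v))
      (a := (1 : ℂ)) (by simp)).tsum_eq
    exact h.symm
  nonsplit_val := fun v _ h => (h trivial).elim

/-- `Σ_{v ≥ 1} (v+2)^{-3/2} < ∞`. -/
theorem summable : Summable fun v : {w : ℕ // w ∉ ({0} : Finset ℕ)} => tOf (q v.1) := by
  have hinj : Function.Injective fun v : {w : ℕ // w ∉ ({0} : Finset ℕ)} => q v.1 := by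
    intro v w h
    apply Subtype.ext
    have h' : v.1 + 2 = w.1 + 2 := h
    omega
  have h := (Real.summable_nat_rpow.mpr (show (-(3 / 2 : ℝ)) < -1 by norm_num)).comp_injective hinj
  exact h

/-- the toy Euler product value -/
def P : ℝ := ∏' v, I v

/-- (Ported verbatim from the HodgeCMPerL package; no docstring in the source.) -/
theorem ram_pos : ∀ v ∈ ({0} : Finset ℕ), 0 < I v := by
  intro v hv
  rw [Finset.mem_singleton] at hv
  subst hv
  simp [I]

/-- (Ported verbatim from the HodgeCMPerL package; no docstring in the source.) -/
theorem P_pos : 0 < P := tprod_pos tail ram_pos summable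

/-- **The toy local-factor datum** (theta vector `1 ∈ ℂ`, `vol = 1`, `c = P⁻¹`). -/
def datum : LocalFactorDatum ℕ ℂ where
  I := I
  S := {0}
  q := q
  chiPi := fun _ => 1
  nuPi := fun _ => 1
  IsSplit := fun _ => True
  c := P⁻¹
  vol := 1
  c_pos := inv_pos.mpr P_pos
  vol_pos := one_pos
  theta := 1
  Theta := {1}
  theta_mem := rfl
  two_le_q := fun v _ => two_le_q v
  chi_norm := fun _ _ => by simp
  nu_norm := fun _ _ => by simp
  ram_pos := ram_pos
  split_val := fun v hv hs => by
    rw [one_mul]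
    exact tail.split_val v hv hs
  nonsplit_val := fun v _ h => (h trivial).elim
  summable_t := summable
  rallis := by
    have hP : P⁻¹ * 1 * ∏' v, I v = 1 := by
      rw [mul_one]
      exact inv_mul_cancel₀ P_pos.ne'
    rw [hP]
    simp

/-- The analytic half holds in the toy model (so `AnalyticHalf` is satisfiable). -/
theorem analyticHalf_datum : AnalyticHalf datum := analyticHalf datum

/-- The toy value of `⟨θ,θ⟩` is `1`, and the datum's Euler value is the positive number `P`. -/
theorem tprod_eq : ∏' v, datum.I v = P := rfl

/-- **The toy side outputs** over the prior programme's one-point torus (`allowed ≡ True`): both lines carry the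
toy datum; the Def 3.2 bridge is trivially true there. -/
def side : SideOutputs Perl34.SmokeS4.torus ℕ where
  fst := fun _ => datum
  snd := fun _ => datum
  allowed_of_pair := fun _ _ _ => trivial

/-- `SideOutputs`, hence `CharsDischarge`, is INHABITED in a concrete model. -/
theorem sideOutputs_nonempty : Nonempty (SideOutputs Perl34.SmokeS4.torus ℕ) := ⟨side⟩

/-- (Ported verbatim from the HodgeCMPerL package; no docstring in the source.) -/
theorem charsDischarge_nonempty : Nonempty (Perl34.C4.CharsDischarge Perl34.SmokeS4.torus ℕ) :=
  ⟨side.charsDischarge⟩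

/-- and the consumed conclusion is derivable there through the general theorem. -/
theorem allowed_all_smoke : ∀ χ : Perl34.SmokeS4.torus.X, Perl34.SmokeS4.torus.allowed χ :=
  side.allowed_all

end Smoke
end EulerProduct
end PerL34
end HodgeCM

end
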